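import Mathlib

/-!
# ℚ(√3) lies in no cyclic quartic field: `a² − 3b² = 3u²` has no non-zero integer solution
(P2-Zeta8Classes v1 §2 (D1); seat p2, pub-hodge-repro0)

A cyclic quartic field containing `ℚ(√3)` would be `ℚ(√β)` with `β ∈ ℚ(√3)` of norm `N(β) ∈ 3·ℚ^{×2}`; clearing denominators,
`β = a + b√3` with `a² − 3b² = 3u²` in integers, `(a, b) ≠ 0`. The theorem below shows this is impossible (descent modulo 3),
so the «cyclic class» of Theorem K (iii) (K = ℚ(ζ₁₂), K_D⁺ = ℚ(√3)(√β) cyclic quartic) is EMPTY. (Classically: `3` is not a sum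
of two squares, so `−1` is not a norm from `ℚ(√3)`.)
-/

namespace HodgeRepro0.NoCyclicQuarticOverSqrt3

/-- a square is `0` or `1` modulo `3` -/
lemma sq_emod_three (x : ℤ) : x ^ 2 % 3 = 0 ∨ x ^ 2 % 3 = 1 := by
  have h0 : 0 ≤ x % 3 := Int.emod_nonneg x (by norm_num)
  have h3 : x % 3 < 3 := Int.emod_lt_of_pos x (by norm_num)
  have : x ^ 2 % 3 = (x % 3) * (x % 3) % 3 := by rw [pow_two, Int.mul_emod]
  rw [this]
  interval_cases (x % 3) <;> simp

/-- if `3 ∣ b² + u²` then `3 ∣ b` and `3 ∣ u` -/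
lemma three_dvd_of_sq_add_sq {b u : ℤ} (h : (3 : ℤ) ∣ b ^ 2 + u ^ 2) : 3 ∣ b ∧ 3 ∣ u := by
  have hb := sq_emod_three b
  have hu := sq_emod_three u
  have hsum : (b ^ 2 + u ^ 2) % 3 = 0 := Int.emod_eq_zero_of_dvd h
  have hadd : (b ^ 2 + u ^ 2) % 3 = ((b ^ 2 % 3) + (u ^ 2 % 3)) % 3 := Int.add_emod _ _ _
  have hb0 : b ^ 2 % 3 = 0 := by omega
  have hu0 : u ^ 2 % 3 = 0 := by omega
  exact ⟨Int.prime_three.dvd_of_dvd_pow (Int.dvd_of_emod_eq_zero hb0),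
         Int.prime_three.dvd_of_dvd_pow (Int.dvd_of_emod_eq_zero hu0)⟩

/-- descent: every solution of `a² − 3b² = 3u²` with `|a| ≤ n` is the zero solution -/
lemma descent (n : ℕ) : ∀ a b u : ℤ, a.natAbs ≤ n → a ^ 2 - 3 * b ^ 2 = 3 * u ^ 2 → a = 0 ∧ b = 0 ∧ u = 0 := by
  induction n with
  | zero =>
    intro a b u ha h
    have ha0 : a = 0 := Int.natAbs_eq_zero.mp (Nat.le_zero.mp ha)
    subst ha0
    have hb : b ^ 2 = 0 := by nlinarith [sq_nonneg b, sq_nonneg u]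
    have hu : u ^ 2 = 0 := by nlinarith [sq_nonneg b, sq_nonneg u]
    exact ⟨rfl, pow_eq_zero_iff (by norm_num) |>.mp hb, pow_eq_zero_iff (by norm_num) |>.mp hu⟩
  | succ n ih =>
    intro a b u ha h
    -- `3 ∣ a`
    have h3a : (3 : ℤ) ∣ a := by
      have : (3 : ℤ) ∣ a ^ 2 := ⟨b ^ 2 + u ^ 2, by linarith⟩
      exact Int.prime_three.dvd_of_dvd_pow this
    obtain ⟨a', rfl⟩ := h3a
    -- `3 a'² = b² + u²`, hence `3 ∣ b`, `3 ∣ u`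
    have h2 : 3 * a' ^ 2 = b ^ 2 + u ^ 2 := by nlinarith
    have h3bu : (3 : ℤ) ∣ b ^ 2 + u ^ 2 := ⟨a' ^ 2, by linarith⟩
    obtain ⟨⟨b', rfl⟩, ⟨u', rfl⟩⟩ := three_dvd_of_sq_add_sq h3bu
    -- the same equation for `(a', b', u')`
    have h' : a' ^ 2 - 3 * b' ^ 2 = 3 * u' ^ 2 := by nlinarith
    have hsize : a'.natAbs ≤ n := by
      have : (3 * a').natAbs = 3 * a'.natAbs := Int.natAbs_mul 3 a'
      omega
    obtain ⟨ha', hb', hu'⟩ := ih a' b' u' hsize h'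
    subst ha' hb' hu'
    simp

/-- `a² − 3b² = 3u²` has only the zero solution in integers -/
theorem no_nonzero_solution (a b u : ℤ) (h : a ^ 2 - 3 * b ^ 2 = 3 * u ^ 2) : a = 0 ∧ b = 0 ∧ u = 0 :=
  descent a.natAbs a b u le_rfl h

/-- in particular `3` is not the norm of an element `a + b√3 ≠ 0` of `ℚ(√3)` up to rational squares (`u ≠ 0`) -/
theorem no_solution_with_u_ne_zero (a b u : ℤ) (hu : u ≠ 0) : a ^ 2 - 3 * b ^ 2 ≠ 3 * u ^ 2 :=
  fun h => hu (no_nonzero_solution a b u h).2.2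

end HodgeRepro0.NoCyclicQuarticOverSqrt3
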